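import Literature.MathematicalPhysics.QuantumFieldTheory.Balaban1983to89.B9KnitTransporterLocalityY
import Literature.MathematicalPhysics.QuantumFieldTheory.Balaban1983to89.B9Cor36GCubeLocDefectTransfer
import Literature.MathematicalPhysics.QuantumFieldTheory.Balaban1983to89.B9WalkLettersOps

/-!
# BalabanUVNodes ∕ N06 ([B9], `Dag.B9_main`) — WITNESS «ZG₁»: THE COVER-GEOMETRY ROWS `hSh hSH hnear hSnear hSblk` OF THE P4-PINNED KNIT HEADS («KE₁₁X-A» ∕ «KESC-AE») ARE JOINTLY
# INHABITED at every member — `S □ := {z : NearH □ z}` (r05's near region itself), `near □ := univ`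
Track A of `YM-PLAN.md` (cell `pub-ymgap`, HUMAN RULING D-0062), node **N06**.  Seat `pub-ymgap-dag-n06-d` g32.  A REFEREE AID in the style of the numerics witnesses «ZK»: after
«KE₁₁X-A» the four law rows of ED.121's generic cube letter `O` are theorems at print's `G′_□(U) = GpDirY x.toKIdx □ (parKnitY x.toKIdx) (S x □)` modulo the GEOMETRIC rows
`hSh : supp h_□ ⊆ S □`, `hSH : S □ ⊆ NearH □`, `hnear : nearDomY x □ ⊆ near □`, `hSnear : S □ ⊆ near □`, `hSblk : knitReachY x.toKIdx □ (S □) ⊆ near □` on the two free families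
`S near : cubes → Finset (SiteY x.toKIdx)`.  THIS FILE shows they are SATISFIABLE TOGETHER (so the edition did not trade hypotheses for an empty premise): take `S □` = the sites of
`NearH □` (print's `Ω₀(□)` may be any such set; `supp h_□ ⊂ NearH □` is ✓`B9Cor36GCubeLocDefectTransfer.nearH_of_hTY_ne_zero`) and the trivial reading domain `near □ = univ`.
HONEST: a satisfiability witness only — at `near := univ` the certificate's `LocDep` conclusion is vacuous (every `U`-dependence allowed); print's reading domain is `□̃⁵` (p. 410
L14–15) and the matching `S = Ω₀(□)` is dag-n06-c's D3 placement.  0 `def`, 0 `sorry`; count-neutral helper (`--supports stmt-QuantumFields-27239 --as helper`); nothing of [B9]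
asserted; N06 NOT discharged; nothing continuum ∕ OS ∕ mass gap ∕ Clay.
[cite: Balaban1985BackgroundPropagators, p.394 L24–33, p.408 l.35–p.409 l.5, p.410 L14–15 («Ω₀(□) ⊂ □̃⁵»), (3.87) p.409]
-/
noncomputable section

namespace Summit.QuantumFields.YangMills.BalabanUVNodes.N06CubeGeometryWitness
open Literature.MathematicalPhysics.QuantumFieldTheory.Balaban1983to89
open Literature.MathematicalPhysics.QuantumFieldTheory.Balaban1983to89.Node00
open Literature.MathematicalPhysics.QuantumFieldTheory.Balaban1983to89.B6Cover236MultiLevelBlocks (cubes)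
open Literature.MathematicalPhysics.QuantumFieldTheory.Balaban1983to89.B9PinMembersKLevelV1 (MemberY)
open Literature.MathematicalPhysics.QuantumFieldTheory.Balaban1983to89.B9CubeSequence408 (NearH)
open Literature.MathematicalPhysics.QuantumFieldTheory.Balaban1983to89.B9Thm37CubeCoverCommutators (hTY)
open Literature.MathematicalPhysics.QuantumFieldTheory.Balaban1983to89.B9Cor36GCubeLocDefectTransfer (nearH_of_hTY_ne_zero)
open Literature.MathematicalPhysics.QuantumFieldTheory.Balaban1983to89.B9WalkLettersOps (nearDomY)
open Literature.MathematicalPhysics.QuantumFieldTheory.Balaban1983to89.B9KnitTransporterLocalityY (knitReachY)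

variable {d ℓ : ℕ} {hd : 1 ≤ d + 1} {hL : Odd (ℓ + 1) ∧ 1 < ℓ + 1} {b₀ b₁ : ℝ} {Mstar : ℕ}

open Classical in
/-- ★ **«ZG₁»: THE FIVE COVER-GEOMETRY ROWS OF «KE₁₁X-A» ∕ «KESC-AE» ARE JOINTLY INHABITED** at every member: `S □ := {z : NearH □ z}`, `near □ := univ` satisfy
`hSh` (`supp h_□ ⊂ NearH □`), `hSH` (by definition), `hnear`, `hSnear`, `hSblk` (everything is inside `univ`).  Satisfiability only; print's `near = □̃⁵`, `S = Ω₀(□)` are the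
supplier's placement. [cite: Balaban1985BackgroundPropagators, p.394 L24–33, p.410 L14–15, (3.87) p.409] -/
theorem geometry_inhabited (x : MemberY d ℓ hd hL b₀ b₁ Mstar) :
    ∃ S near : ↥(cubes x.toKIdx.D.toDomains) → Finset (SiteY x.toKIdx),
      (∀ (c' : ↥(cubes x.toKIdx.D.toDomains)) (z : SiteY x.toKIdx), hTY x.toKIdx c' z ≠ 0 → z ∈ S c') ∧
      (∀ (c' : ↥(cubes x.toKIdx.D.toDomains)) (z : SiteY x.toKIdx), z ∈ S c' → NearH c' z.1) ∧
      (∀ c' : ↥(cubes x.toKIdx.D.toDomains), nearDomY x c' ⊆ near c') ∧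
      (∀ c' : ↥(cubes x.toKIdx.D.toDomains), S c' ⊆ near c') ∧
      (∀ c' : ↥(cubes x.toKIdx.D.toDomains), knitReachY x.toKIdx c' (S c') ⊆ near c') := by
  refine ⟨fun c' => Finset.univ.filter fun z => NearH c' z.1, fun _ => Finset.univ, ?_, ?_, ?_, ?_, ?_⟩
  · intro c' z hz
    exact Finset.mem_filter.2 ⟨Finset.mem_univ _, nearH_of_hTY_ne_zero x.toKIdx c' hz⟩
  · intro c' z hz
    exact (Finset.mem_filter.1 hz).2
  · exact fun _ => Finset.subset_univ _
  · exact fun _ => Finset.subset_univ _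
  · exact fun _ => Finset.subset_univ _

end Summit.QuantumFields.YangMills.BalabanUVNodes.N06CubeGeometryWitness

end
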